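import Literature.AnabelianGeometry.EtaleTheta.ThetaSettingHatThetaCompanion
import Literature.AnabelianGeometry.EtaleTheta.SettingModelFreeGroup
import Literature.AnabelianGeometry.SemiGraphs.ProfiniteCompletionEta
import Literature.AnabelianGeometry.AbsoluteAnabelian.LocalReciprocityCofinal
import Literature.IUT.HodgeTheaters.ProfiniteCompletionRestrictOpen
import Literature.AnabelianGeometry.EtaleTheta.Discharge.Sec1Thm16Carriers
import HarnessLib

/-!
# [EtTh] Rmk. 1.6.4 «[so `Π_X/Π_{Y^∧} ≅ Ẑ`]»: the completed quotient `Π_X ↠ Ẑ` of `Π^tp_X ↠ Z ≅ ℤ` and its kernel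
# `Π_{Y^∧}` = the CLOSURE of `Π^tp_Y` — as THEOREMS over the `ThetaSetting` / `TemperedCurve` interfaces

S. Mochizuki, *The Étale Theta Function …* [EtTh], Publ. RIMS **45** (2009), §1, PDF p. 12 (PRIMS p. 238): "a natural
surjection `Π^tp_X ↠ Z` whose kernel, which we denote by `Π^tp_Y`, …; `Z = Gal(Y/X) (≅ ℤ)`. Write `Π_X = (Π^tp_X)^∧`"
[cite: MochizukiEtTh2009, §1 p.12]; Remark 1.6.4, PDF p. 26 (PRIMS p. 252): "if we denote by `(Ÿ^log)^∧ → (Y^log)^∧ →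
X^log` the profinite étale coverings determined by the tempered coverings `Ÿ^log → Y^log → X^log` [so `Π_X/Π_{Y^∧} ≅
Ẑ`]" [cite: MochizukiEtTh2009, Rmk 1.6.4 p.26].

Layer L2 of the abc-iut cell, seat abc-iut-f-142 gen 8, row «TOZHAT» (abc-iut-L2-lead gen 9 R1335 key «RMK164-(r1)
ẐCLASS», sized HONEST-NO as an S item; this file is the S–M print-faithful deliverable offered instead: the bracket
«so `Π_X/Π_{Y^∧} ≅ Ẑ`» of Rmk. 1.6.4, and ingredient #1 — the index `a := toZHat σ̂ ∈ Ẑ` — of any future a ∈ Ẑ form of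
(c2)).  Over abc-iut-L2-t1's frozen `ThetaSetting` (`toZ : Π^tp_X ↠ ℤ`, `isOpen_ker_toZ`) and abc-iut-L3's `TemperedCurve`
(`toHat : Π^tp_X → Π_X` a profinite completion), with `Ẑ :=` Mathlib's profinite completion of `ℤ` (abc-iut-L2-t1's
`etaCont`, `isProfiniteCompletion_of_eta`) and the universal property packaged in abc-iut-f-142's
`IsProfiniteCompletion.lift` (p509804, over abc-iut-w5-d139's `exists_extension` / `extension_unique`):

* `ThetaSetting.toZCont` — `toZ` as a continuous homomorphism (continuity = `Thm16Sub.continuous_toZ`, BY NAME); `ThetaSetting.ZHat`, `etaZ : ℤ → Ẑ`;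
* **`ThetaSetting.toZHat : Π_X →ₜ* Ẑ`** — THE continuous extension of `η ∘ toZ` along `toHat` (`toZHat_toHat`,
  `toZHat_unique`), surjective (`toZHat_surjective`: compact image containing the dense `η(ℤ)`);
* **`ker_toZHat : Ker(toZHat) = Π_{Y^∧}`** — the kernel is EXACTLY abc-iut-f-142's `GtpYHat` (the closure of `toHat(Π^tp_Y)`,
  reading (a) of record R1227): `⊇` by continuity; `⊆` because, in the profinite quotient `Q := Π_X ⧸ Π_{Y^∧}` (Hausdorff and
  totally disconnected by abc-iut-L4's `QuotientGroup.totallyDisconnectedSpace_of_isClosed`), the induced `τ : Q → Ẑ` has a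
  continuous section `ρ : Ẑ → Q` (the lift of `n ↦ [toHat σ]^n`, `toZ σ = 1`) with `ρ ∘ τ = id` on the dense image of
  `Π^tp_X = Π^tp_Y · σ^ℤ` — so `τ` is injective ("`Π_X/Π_{Y^∧}` is procyclic on `toHat σ`");
* `gtpYHat_normal` (a THEOREM, no instance: consumers `haveI`), and **`quotientGtpYHatEquivZHat : Π_X ⧸ Π_{Y^∧} ≃* Ẑ`**
  — print's bracket «so `Π_X/Π_{Y^∧} ≅ Ẑ`» (group isomorphism induced by `toZHat`; the `[Π_{Y^∧}.Normal]` instance is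
  taken as an argument per the L2 convention R1304).

DEF-BEARING (`ZHat`, `etaZ`, `toZCont`, `toZHat`, `quotientGtpYHatEquivZHat`); no `instance`, no notation, no
`Prop`-fact; nothing of [EtTh] Rmk. 1.6.4 beyond its bracket is asserted (the Ẑ-form of (c2) stays DISPLAYED, residual
(r1) of R1318); no side is taken on [IUTchIII] Cor. 3.12; nothing here asserts that abc is proved or refuted; typed ≠ proved.
-/

noncomputable section

namespace Literature.AnabelianGeometry.EtaleTheta

namespace ThetaSetting

open Topology
open Literature.AnabelianGeometry.SemiGraphs

variable {p : ℕ} [Fact p.Prime] (D : ThetaSetting p)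

/-! ### §1. `Ẑ` and the continuity of `toZ` -/

/-- `Ẑ`, the profinite completion of `Z ≅ ℤ` ("`Z = Gal(Y/X) (≅ ℤ)`", p. 12; "`Π_X/Π_{Y^∧} ≅ Ẑ`", Rmk. 1.6.4 p. 26):
Mathlib's profinite completion of the discrete group `ℤ` (written multiplicatively), as a type carrying its profinite
group instances. [cite: MochizukiEtTh2009, Rmk 1.6.4 p.26] -/
abbrev ZHat : Type :=
  (ProfiniteGrp.ProfiniteCompletion.completion (GrpCat.of (Multiplicative ℤ)) : Type)

/-- `η : ℤ → Ẑ`, the canonical continuous homomorphism (abc-iut-L2-t1's `etaCont` at `ℤ`).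
[cite: MochizukiEtTh2009, Rmk 1.6.4 p.26] -/
abbrev etaZ : Multiplicative ℤ →ₜ* ZHat := SettingModel.etaCont (Multiplicative ℤ)

/-- `η : ℤ → Ẑ` is a profinite completion in abc-iut-L3's sense (abc-iut-L2-t1's `isProfiniteCompletion_of_eta`).
[cite: MochizukiSemiAnbd2006, §6 p.69] -/
theorem isProfiniteCompletion_etaZ : IsProfiniteCompletion etaZ :=
  isProfiniteCompletion_of_eta _ fun _ => rfl

/-- `Π^tp_X ↠ Z ≅ ℤ` as a continuous homomorphism — `toZ` IS continuous because its kernel `Π^tp_Y` is open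
(abc-iut-L6-d5 lineage's `Thm16Sub.continuous_toZ`, "the discreteness of the topological group `Z`", p. 24, BY NAME).
[cite: MochizukiEtTh2009, §1 p.12] -/
def toZCont : D.PiTemp →ₜ* Multiplicative ℤ where
  toMonoidHom := D.toZ
  continuous_toFun := Thm16Sub.continuous_toZ D

/-- `toZCont = toZ` pointwise. [cite: MochizukiEtTh2009, §1 p.12] -/
theorem toZCont_apply (g : D.PiTemp) : D.toZCont g = D.toZ g := rfl

/-! ### §2. The completed quotient `toZHat : Π_X ↠ Ẑ` -/

/-- **`Π_X → Ẑ`, the completion of `Π^tp_X ↠ Z ≅ ℤ`** (Rmk. 1.6.4 «so `Π_X/Π_{Y^∧} ≅ Ẑ`»): THE continuous homomorphism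
extending `η ∘ toZ` along the profinite completion `toHat` (abc-iut-f-142's `IsProfiniteCompletion.lift`).
[cite: MochizukiEtTh2009, Rmk 1.6.4 p.26] -/
def toZHat : D.PiHat →ₜ* ZHat :=
  D.isProfiniteCompletion_toHat.lift (etaZ.comp D.toZCont)

/-- `toZHat (toHat g) = η (toZ g)`. [cite: MochizukiEtTh2009, Rmk 1.6.4 p.26] -/
theorem toZHat_toHat (g : D.PiTemp) : D.toZHat (D.toHat g) = etaZ (D.toZ g) :=
  D.isProfiniteCompletion_toHat.lift_ι _ g

/-- Uniqueness: a continuous homomorphism `Π_X → Ẑ` extending `η ∘ toZ` IS `toZHat`. [cite: MochizukiEtTh2009, Rmk 1.6.4 p.26] -/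
theorem toZHat_unique (Φ : D.PiHat →ₜ* ZHat) (h : ∀ g : D.PiTemp, Φ (D.toHat g) = etaZ (D.toZ g)) :
    Φ = D.toZHat :=
  D.isProfiniteCompletion_toHat.lift_unique _ Φ h

/-- `toZHat` is SURJECTIVE: its image is compact, hence closed, and contains the dense `η(ℤ)` (`toZ` is onto).
[cite: MochizukiEtTh2009, Rmk 1.6.4 p.26] -/
theorem toZHat_surjective : Function.Surjective D.toZHat := by
  haveI : CompactSpace D.PiHat := D.isProfiniteCompletion_toHat.compactSpace
  have hcl : IsClosed (Set.range D.toZHat) := (isCompact_range D.toZHat.continuous).isClosed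
  have hdense : Dense (Set.range D.toZHat) := by
    refine isProfiniteCompletion_etaZ.denseRange.mono ?_
    rintro _ ⟨n, rfl⟩
    obtain ⟨g, hg⟩ := D.toZ_surjective n
    exact ⟨D.toHat g, by rw [toZHat_toHat, hg]⟩
  intro y
  have hy : y ∈ closure (Set.range D.toZHat) := hdense y
  rwa [hcl.closure_eq] at hy

/-! ### §3. The kernel: `Ker(Π_X ↠ Ẑ) = Π_{Y^∧}` -/

/-- `Π_{Y^∧} = cl toHat(Π^tp_Y)` is NORMAL in `Π_X` (closed, and normalised by the dense `toHat(Π^tp_X)` since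
`Π^tp_Y ⊴ Π^tp_X`).  A THEOREM (no instance is registered; consumers `haveI := D.gtpYHat_normal`).
[cite: MochizukiEtTh2009, Rmk 1.6.4 p.26] -/
theorem gtpYHat_normal : D.GtpYHat.Normal := by
  refine Literature.IUT.HodgeTheaters.ProfiniteCompletionRestrict.normal_of_dense_conj D.GtpYHat
    (Subgroup.isClosed_topologicalClosure _) D.isProfiniteCompletion_toHat.denseRange ?_
  rintro _ ⟨x, rfl⟩ h hh
  refine Literature.IUT.HodgeTheaters.ProfiniteCompletionRestrict.conj_mem_topologicalClosure_of_forall _ _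
    (fun k hk => ?_) h hh
  obtain ⟨y, hy, rfl⟩ := hk
  have hyn : x * y * x⁻¹ ∈ D.GtpY := by
    rw [GtpY] at hy ⊢
    exact (MonoidHom.normal_ker D.toZ).conj_mem y hy x
  exact ⟨x * y * x⁻¹, hyn, by simp only [map_mul, map_inv]; rfl⟩

/-- `Π_{Y^∧} ≤ Ker(toZHat)`: `toZHat` kills `toHat(Π^tp_Y)` and its kernel is closed. [cite: MochizukiEtTh2009, Rmk 1.6.4 p.26] -/
theorem gtpYHat_le_ker_toZHat : D.GtpYHat ≤ D.toZHat.toMonoidHom.ker := by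
  rw [GtpYHat]
  refine Subgroup.topologicalClosure_minimal _ ?_ ?_
  · rintro _ ⟨y, hy, rfl⟩
    have hy1 : D.toZ y = 1 := by
      rw [SetLike.mem_coe, GtpY, MonoidHom.mem_ker] at hy; exact hy
    rw [MonoidHom.mem_ker]
    change D.toZHat (D.toHat y) = 1
    rw [toZHat_toHat, hy1, map_one]
  · have hset : ((D.toZHat.toMonoidHom.ker : Subgroup D.PiHat) : Set D.PiHat) = D.toZHat ⁻¹' {1} := by
      ext z; simp [MonoidHom.mem_ker]
    rw [hset]
    exact isClosed_singleton.preimage D.toZHat.continuous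

/-- **`Ker(Π_X ↠ Ẑ) = Π_{Y^∧}`** — the completed quotient has kernel EXACTLY the closure of `toHat(Π^tp_Y)` (print's
«`(Y^log)^∧` … the profinite étale covering determined by the tempered covering `Y^log → X^log` [so `Π_X/Π_{Y^∧} ≅ Ẑ`]»):
in the profinite quotient `Q = Π_X ⧸ Π_{Y^∧}` the induced map `τ : Q → Ẑ` has the continuous section
`ρ := lift (n ↦ [toHat σ]^n)` (`toZ σ = 1`) with `ρ ∘ τ = id` on the dense image of `Π^tp_X = Π^tp_Y · σ^ℤ`, hence
everywhere; so `τ` is injective. [cite: MochizukiEtTh2009, Rmk 1.6.4 p.26] -/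
theorem ker_toZHat : D.toZHat.toMonoidHom.ker = D.GtpYHat := by
  classical
  refine le_antisymm ?_ D.gtpYHat_le_ker_toZHat
  haveI hN : D.GtpYHat.Normal := D.gtpYHat_normal
  haveI : CompactSpace D.PiHat := D.isProfiniteCompletion_toHat.compactSpace
  haveI : T2Space D.PiHat := D.isProfiniteCompletion_toHat.t2Space
  haveI : TotallyDisconnectedSpace D.PiHat := D.isProfiniteCompletion_toHat.totallyDisconnectedSpace
  haveI : TotallyDisconnectedSpace (D.PiHat ⧸ D.GtpYHat) :=
    AbsoluteAnabelian.QuotientGroup.totallyDisconnectedSpace_of_isClosed _ (Subgroup.isClosed_topologicalClosure _)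
  -- the quotient map and the induced `τ : Q → Ẑ`
  set π : D.PiHat →* D.PiHat ⧸ D.GtpYHat := QuotientGroup.mk' D.GtpYHat with hπ
  let τ : D.PiHat ⧸ D.GtpYHat →* ZHat :=
    QuotientGroup.lift D.GtpYHat D.toZHat.toMonoidHom D.gtpYHat_le_ker_toZHat
  have hτπ : ∀ z : D.PiHat, τ (π z) = D.toZHat z := fun z => rfl
  have hτc : Continuous τ := by
    rw [(QuotientGroup.isQuotientMap_mk (D.GtpYHat)).continuous_iff]
    exact D.toZHat.continuous
  -- a generator: `σ ∈ Π^tp_X` with `toZ σ = 1`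
  obtain ⟨σ, hσ⟩ := D.toZ_surjective (Multiplicative.ofAdd 1)
  -- the section `ρ : Ẑ → Q`, the lift of `n ↦ π(toHat σ)^n` along `η : ℤ → Ẑ`
  let ψ : Multiplicative ℤ →ₜ* D.PiHat ⧸ D.GtpYHat :=
    { toMonoidHom := (zpowersHom (D.PiHat ⧸ D.GtpYHat) (π (D.toHat σ)))
      continuous_toFun := continuous_of_discreteTopology }
  let ρ : ZHat →ₜ* D.PiHat ⧸ D.GtpYHat := isProfiniteCompletion_etaZ.lift ψ
  have hρ : ∀ n : Multiplicative ℤ, ρ (etaZ n) = π (D.toHat σ) ^ n.toAdd := fun n => by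
    rw [show ρ (etaZ n) = ψ n from isProfiniteCompletion_etaZ.lift_ι ψ n]
    rfl
  -- `ρ ∘ τ = id` on the dense image of `Π^tp_X`: write `x = y · σ^n`, `y ∈ Π^tp_Y`, `n = toZ x`
  have hsec : ∀ x : D.PiTemp, ρ (τ (π (D.toHat x))) = π (D.toHat x) := by
    intro x
    set n : ℤ := (D.toZ x).toAdd with hn
    have hy : x * (σ ^ n)⁻¹ ∈ D.GtpY := by
      rw [GtpY, MonoidHom.mem_ker, map_mul, map_inv, map_zpow, hσ]
      rw [← ofAdd_zsmul, smul_eq_mul, mul_one, hn, ofAdd_toAdd, mul_inv_cancel]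
    have hyhat : π (D.toHat (x * (σ ^ n)⁻¹)) = 1 := by
      rw [hπ, QuotientGroup.mk'_apply, QuotientGroup.eq_one_iff, GtpYHat]
      exact Subgroup.le_topologicalClosure _ ⟨_, hy, rfl⟩
    have hx : π (D.toHat x) = π (D.toHat σ) ^ n := by
      have : x = (x * (σ ^ n)⁻¹) * σ ^ n := by rw [inv_mul_cancel_right]
      conv_lhs => rw [this]
      rw [map_mul, map_mul, hyhat, one_mul, map_zpow, map_zpow]
    rw [hτπ, toZHat_toHat, hρ, hx]
  -- by density of `π(toHat(Π^tp_X))` in `Q` and continuity, `ρ ∘ τ = id`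
  have hdense : DenseRange (fun x : D.PiTemp => π (D.toHat x)) :=
    ((QuotientGroup.mk'_surjective D.GtpYHat).denseRange.comp D.isProfiniteCompletion_toHat.denseRange
      QuotientGroup.continuous_mk)
  have hid : ∀ q : D.PiHat ⧸ D.GtpYHat, ρ (τ q) = q := by
    have heq := Continuous.ext_on hdense (ρ.continuous.comp hτc) continuous_id
      (fun q ⟨x, hx⟩ => by subst hx; exact hsec x)
    exact fun q => congrFun heq q
  -- hence `τ` is injective and `Ker toZHat = π⁻¹(Ker τ) = Π_{Y^∧}`
  intro z hz
  rw [MonoidHom.mem_ker] at hz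
  have h1 : τ (π z) = 1 := by rw [hτπ]; exact hz
  have h2 : π z = 1 := by rw [← hid (π z), h1, map_one]
  rwa [hπ, QuotientGroup.mk'_apply, QuotientGroup.eq_one_iff] at h2

/-! ### §4. Print's bracket: `Π_X ⧸ Π_{Y^∧} ≅ Ẑ` -/

/-- **«so `Π_X/Π_{Y^∧} ≅ Ẑ`»** (Rmk. 1.6.4): the group isomorphism induced by the completed quotient `toZHat` — onto by
`toZHat_surjective`, kernel `Π_{Y^∧}` by `ker_toZHat`.  (The normality instance of `Π_{Y^∧}` is an ARGUMENT, supplied by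
`haveI := D.gtpYHat_normal`; no instance is registered in this file.) [cite: MochizukiEtTh2009, Rmk 1.6.4 p.26] -/
def quotientGtpYHatEquivZHat [D.GtpYHat.Normal] : D.PiHat ⧸ D.GtpYHat ≃* ZHat :=
  (QuotientGroup.quotientMulEquivOfEq D.ker_toZHat.symm).trans
    (QuotientGroup.quotientKerEquivOfSurjective D.toZHat.toMonoidHom D.toZHat_surjective)

/-- The isomorphism on cosets: `[z] ↦ toZHat z`. [cite: MochizukiEtTh2009, Rmk 1.6.4 p.26] -/
theorem quotientGtpYHatEquivZHat_mk [D.GtpYHat.Normal] (z : D.PiHat) :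
    D.quotientGtpYHatEquivZHat (QuotientGroup.mk z) = D.toZHat z := rfl

end ThetaSetting

end Literature.AnabelianGeometry.EtaleTheta

end
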